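import Literature.MathematicalPhysics.QuantumLattice.BogoliubovInequalityGeneral
import Mathlib.Analysis.MeanInequalities
import Mathlib.Analysis.SpecialFunctions.Pow.Continuity
import HarnessLib

/-!
# The logarithmic-mean bound on the Duhamel two-point function

For a Hermitian `H : Matrix n n ℂ`, an inverse temperature `β` and any `A : Matrix n n ℂ`, the Duhamel
two-point function `(Aᴴ, A)_β = Z⁻¹ ∫₀¹ tr(Aᴴ e^{-sβH} A e^{-(1-s)βH}) ds` (`Matrix.duhamel β H Aᴴ A`)
satisfies

  `Re (Aᴴ, A)_β ≤ ∫₀¹ (Re⟨AAᴴ⟩_β)^s (Re⟨AᴴA⟩_β)^{1-s} ds = L(Re⟨AAᴴ⟩_β, Re⟨AᴴA⟩_β)`,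

the LOGARITHMIC MEAN `L(a,b) = (a − b)/(log a − log b) = ∫₀¹ a^s b^{1-s} ds` of the two equal-time
expectations (`re_duhamel_conjTranspose_mul_self_le_integral_rpow`). This is Dyson–Lieb–Simon's
three-line bound [DLS1978] (26), `|f(ix)| ≤ a^x b^{1−x}` with `a = ⟨AA*⟩`, `b = ⟨A*A⟩`, integrated over
`x ∈ [0,1]` by (24c) `(A,B) = ∫₀¹ f(ix) dx` — i.e. the bound BEFORE its final weakening
`a^x b^{1−x} ≤ xa + (1−x)b` to (25) `(A*,A) ≤ ½⟨A*A + AA*⟩` (tree: `re_duhamel_conjTranspose_le`). In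
the energy eigenbasis it is the weighted Hölder inequality
`Σᵢⱼ mᵢⱼ wⱼ^s wᵢ^{1-s} ≤ (Σ mᵢⱼ wⱼ)^s (Σ mᵢⱼ wᵢ)^{1-s}` on the pair sum [DLS1978] (35) (tree
`re_duhamel_conjTranspose_mul_self_eq`), which is how it is proved here; we also record the pointwise
step `∫₀¹ a^s b^{1-s} ds ≤ (a+b)/2` (`integral_rpow_mul_rpow_le_half_add`), so that (25) is recovered.
Combined with the sharp Bogoliubov inequality (`bogoliubov_inequality_duhamel_general`) it gives the
log-mean ("Roepstorff-type") Bogoliubov inequality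
`|⟨[C,A]⟩|² ≤ β L(⟨AAᴴ⟩,⟨AᴴA⟩) ⟨[Cᴴ,[H,C]]⟩` (`bogoliubov_inequality_logMean_general`), the member of
the correlation-inequality family that hubbard-thermal THERMAL-SOURCES §2g (G-3/G-5) shows to be
implied by the matrix energy–entropy balance constraint on the same operator span.

## References

* [DLS1978] F. J. Dyson, E. H. Lieb, B. Simon, *Phase transitions in quantum spin systems with
  isotropic and nonisotropic interactions*, J. Stat. Phys. 18 (1978) 335–383, §2 eqs. (24a)–(24c),
  (25), (26) (p. 346) and §3 eq. (35). Held: `paper:doi-10-1007-978-3-662-10018-9-12`.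

## Design notes

No definition, no named fact. The degenerate case `A = 0` is treated separately (both sides vanish);
for `A ≠ 0` both equal-time expectations are strictly positive (faithfulness of the Gibbs state), so
only positive bases of `Real.rpow` occur and the integrands are continuous.
-/

noncomputable section

open scoped Matrix.Norms.L2Operator ComplexOrder
open Finset MeasureTheory intervalIntegral Matrix

namespace Literature.MathematicalPhysics.QuantumLattice

variable {n : Type*} [Fintype n] [DecidableEq n] {H : Matrix n n ℂ}

/-! ### Weighted Hölder on a finite sum (via the two-point weighted AM–GM inequality) -/

omit [DecidableEq n] in
/-- **Weighted Hölder / log-convexity of a two-weight sum**: for `m ≥ 0`, `u, v > 0` termwise with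
positive totals `U = Σ m u`, `V = Σ m v` and `0 ≤ s ≤ 1`,
`Σ_k m_k u_k^s v_k^{1-s} ≤ U^s V^{1-s}` (apply `p₁^{s} p₂^{1-s} ≤ s p₁ + (1-s) p₂` to
`p₁ = u_k/U`, `p₂ = v_k/V` and sum). [cite: DLS1978, §2 eq. (26)] -/
private theorem sum_mul_rpow_mul_rpow_le {ι : Type*} (S : Finset ι) (m u v : ι → ℝ)
    (hm : ∀ k ∈ S, 0 ≤ m k) (hu : ∀ k ∈ S, 0 ≤ u k) (hv : ∀ k ∈ S, 0 ≤ v k) {s : ℝ} (hs0 : 0 ≤ s)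
    (hs1 : s ≤ 1) (hU : 0 < ∑ k ∈ S, m k * u k) (hV : 0 < ∑ k ∈ S, m k * v k) :
    ∑ k ∈ S, m k * (u k ^ s * v k ^ (1 - s)) ≤
      (∑ k ∈ S, m k * u k) ^ s * (∑ k ∈ S, m k * v k) ^ (1 - s) := by
  set U := ∑ k ∈ S, m k * u k with hUdef
  set V := ∑ k ∈ S, m k * v k with hVdef
  have hU0 : 0 ≤ U := hU.le
  have hV0 : 0 ≤ V := hV.le
  have key : ∀ k ∈ S, m k * (u k ^ s * v k ^ (1 - s)) ≤
      (U ^ s * V ^ (1 - s)) * (m k * (s * (u k / U) + (1 - s) * (v k / V))) := by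
    intro k hk
    have hu' : u k = U * (u k / U) := by field_simp
    have hv' : v k = V * (v k / V) := by field_simp
    have hpu : 0 ≤ u k / U := div_nonneg (hu k hk) hU0
    have hpv : 0 ≤ v k / V := div_nonneg (hv k hk) hV0
    have hag := Real.geom_mean_le_arith_mean2_weighted hs0 (by linarith) hpu hpv (by ring : s + (1 - s) = 1)
    calc m k * (u k ^ s * v k ^ (1 - s))
        = m k * ((U * (u k / U)) ^ s * (V * (v k / V)) ^ (1 - s)) := by rw [← hu', ← hv']
      _ = (U ^ s * V ^ (1 - s)) * (m k * ((u k / U) ^ s * (v k / V) ^ (1 - s))) := by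
          rw [Real.mul_rpow hU0 hpu, Real.mul_rpow hV0 hpv]; ring
      _ ≤ (U ^ s * V ^ (1 - s)) * (m k * (s * (u k / U) + (1 - s) * (v k / V))) :=
          mul_le_mul_of_nonneg_left (mul_le_mul_of_nonneg_left hag (hm k hk))
            (mul_nonneg (Real.rpow_nonneg hU0 _) (Real.rpow_nonneg hV0 _))
  have hsum : ∑ k ∈ S, m k * (s * (u k / U) + (1 - s) * (v k / V)) = 1 := by
    have h1 : ∑ k ∈ S, m k * (s * (u k / U) + (1 - s) * (v k / V)) =
        s / U * (∑ k ∈ S, m k * u k) + (1 - s) / V * (∑ k ∈ S, m k * v k) := by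
      rw [Finset.mul_sum, Finset.mul_sum, ← Finset.sum_add_distrib]
      refine Finset.sum_congr rfl fun k _ => ?_
      rw [div_mul_eq_mul_div, div_mul_eq_mul_div, mul_add, ← mul_assoc, ← mul_assoc, mul_div_assoc,
        mul_div_assoc, mul_comm (m k) s, mul_comm (m k) (1 - s), mul_assoc, mul_assoc, mul_div_assoc,
        mul_div_assoc]
    rw [h1, ← hUdef, ← hVdef, div_mul_cancel₀ _ hU.ne', div_mul_cancel₀ _ hV.ne']
    ring
  calc ∑ k ∈ S, m k * (u k ^ s * v k ^ (1 - s))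
      ≤ ∑ k ∈ S, (U ^ s * V ^ (1 - s)) * (m k * (s * (u k / U) + (1 - s) * (v k / V))) :=
        Finset.sum_le_sum key
    _ = U ^ s * V ^ (1 - s) := by rw [← Finset.mul_sum, hsum, mul_one]

/-- `∫₀¹ a^s b^{1-s} ds ≤ (a + b)/2` for `a, b ≥ 0`: the logarithmic mean is at most the arithmetic
mean (pointwise `a^s b^{1-s} ≤ s a + (1-s) b`, [DLS1978] (26) "`≤ xa + (1−x)b`").
[cite: DLS1978, §2 eq. (26)] -/
theorem integral_rpow_mul_rpow_le_half_add {a b : ℝ} (ha : 0 < a) (hb : 0 < b) :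
    ∫ s in (0 : ℝ)..1, a ^ s * b ^ (1 - s) ≤ (a + b) / 2 := by
  have hcont : Continuous fun s : ℝ => a ^ s * b ^ (1 - s) :=
    (Real.continuous_const_rpow ha.ne').mul
      ((Real.continuous_const_rpow hb.ne').comp (continuous_const.sub continuous_id))
  calc ∫ s in (0 : ℝ)..1, a ^ s * b ^ (1 - s)
      ≤ ∫ s in (0 : ℝ)..1, (b + s * (a - b)) := by
        refine intervalIntegral.integral_mono_on zero_le_one (hcont.intervalIntegrable _ _)
          (Continuous.intervalIntegrable (by fun_prop) _ _) fun s hs => ?_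
        have h := Real.geom_mean_le_arith_mean2_weighted hs.1 (by linarith [hs.2]) ha.le hb.le
          (by ring : s + (1 - s) = 1)
        linarith
    _ = (a + b) / 2 := by rw [integral_affine_unit_interval]; ring

section Spectral

/-- A matrix vanishes iff its rotation `U⋆ a U` by a unitary `U` vanishes. [folklore] -/
private theorem star_mul_mul_eq_zero_iff' {U : Matrix n n ℂ} (hU : U ∈ unitary (Matrix n n ℂ))
    (a : Matrix n n ℂ) : star U * a * U = 0 ↔ a = 0 := by
  constructor
  · intro h
    have : a = U * (star U * a * U) * star U := by
      simp only [Matrix.mul_assoc]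
      rw [Unitary.mul_star_self_of_mem hU, Matrix.mul_one, ← Matrix.mul_assoc,
        Unitary.mul_star_self_of_mem hU, Matrix.one_mul]
    rw [this, h, Matrix.mul_zero, Matrix.zero_mul]
  · rintro rfl
    rw [Matrix.mul_zero, Matrix.zero_mul]

/-- **The logarithmic-mean bound on the Duhamel two-point function** ([DLS1978] (24c) + (26), before the
weakening to (25)): for Hermitian `H`, any `β` and any `A`,
`Re (Aᴴ, A)_β ≤ ∫₀¹ (Re⟨AAᴴ⟩_β)^s (Re⟨AᴴA⟩_β)^{1-s} ds` — the logarithmic mean of the two equal-time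
expectations. Proof: the pair sum `Z·Re(Aᴴ,A) = Σᵢⱼ |A′ⱼᵢ|² K(Eᵢ,Eⱼ) = ∫₀¹ Σᵢⱼ |A′ⱼᵢ|² wⱼ^s wᵢ^{1-s} ds`
([DLS1978] (35)) and the weighted Hölder inequality termwise in `s`, with
`Σᵢⱼ |A′ⱼᵢ|² wⱼ = Z Re⟨AAᴴ⟩`, `Σᵢⱼ |A′ⱼᵢ|² wᵢ = Z Re⟨AᴴA⟩`. [cite: DLS1978, §2 eqs. (24c), (26)] -/
theorem re_duhamel_conjTranspose_mul_self_le_integral_rpow (hH : H.IsHermitian) (A : Matrix n n ℂ)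
    (β : ℝ) :
    (duhamel β H Aᴴ A).re ≤
      ∫ s in (0 : ℝ)..1, (gibbsState β H (A * Aᴴ)).re ^ s * (gibbsState β H (Aᴴ * A)).re ^ (1 - s) := by
  rcases isEmpty_or_nonempty n with hn | hn
  · have h0 : ∀ X : Matrix n n ℂ, gibbsState β H X = 0 := fun X => by
      rw [gibbsState_apply]
      simp [Matrix.trace]
    have h1 : duhamel β H Aᴴ A = 0 := by
      rw [duhamel]
      simp [Matrix.trace]
    simp only [h0, h1, Complex.zero_re]
    exact intervalIntegral.integral_nonneg zero_le_one fun s _ =>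
      mul_nonneg (Real.rpow_nonneg le_rfl _) (Real.rpow_nonneg le_rfl _)
  set U := (hH.eigenvectorUnitary : Matrix n n ℂ) with hU
  have hUm : U ∈ unitary (Matrix n n ℂ) := hH.eigenvectorUnitary.prop
  set E := hH.eigenvalues with hE
  set W : n → ℝ := fun i => Real.exp (-(β * E i)) with hW
  set Zr : ℝ := ∑ i, W i with hZr
  set A' : Matrix n n ℂ := (star hH.eigenvectorUnitary : Matrix n n ℂ) * A * U with hA'
  set m : n → n → ℝ := fun i j => ‖A' j i‖ ^ 2 with hm
  have hZr0 : 0 < Zr := hH.sum_exp_pos β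
  have hW0 : ∀ i, 0 < W i := fun i => Real.exp_pos _
  have hm0 : ∀ i j, 0 ≤ m i j := fun i j => sq_nonneg _
  have hS₁0 : 0 ≤ ∑ i, ∑ j, m i j * W j :=
    sum_nonneg fun i _ => sum_nonneg fun j _ => mul_nonneg (hm0 i j) (hW0 j).le
  have hS₂0 : 0 ≤ ∑ i, ∑ j, m i j * W i :=
    sum_nonneg fun i _ => sum_nonneg fun j _ => mul_nonneg (hm0 i j) (hW0 i).le
  -- the two equal-time expectations as pair sums
  have hu₁ : (gibbsState β H (A * Aᴴ)).re = Zr⁻¹ * ∑ i, ∑ j, m i j * W j := by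
    rw [hH.re_gibbsState, re_trace_gibbsWeight_mul_mul_conjTranspose hH β A, Finset.sum_comm]
    congr 1
    refine sum_congr rfl fun i _ => sum_congr rfl fun j _ => ?_
    simp only [hm, hW, neg_mul]
    ring
  have hu₂ : (gibbsState β H (Aᴴ * A)).re = Zr⁻¹ * ∑ i, ∑ j, m i j * W i := by
    rw [hH.re_gibbsState, re_trace_gibbsWeight_mul_conjTranspose_mul hH β A, Finset.sum_comm]
    congr 1
    refine sum_congr rfl fun i _ => sum_congr rfl fun j _ => ?_
    simp only [hm, hW, neg_mul]
    ring
  -- the degenerate case `A = 0`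
  by_cases hA0 : A = 0
  · have h1 : duhamel β H Aᴴ A = 0 := by
      rw [duhamel, hA0]
      simp [Matrix.trace]
    rw [h1, Complex.zero_re]
    exact intervalIntegral.integral_nonneg zero_le_one fun s _ =>
      mul_nonneg (Real.rpow_nonneg (by rw [hu₁]; exact mul_nonneg (inv_nonneg.2 hZr0.le) hS₁0) _)
        (Real.rpow_nonneg (by rw [hu₂]; exact mul_nonneg (inv_nonneg.2 hZr0.le) hS₂0) _)
  -- `A ≠ 0`: some `m i j > 0`, hence both totals are positive
  obtain ⟨i₀, j₀, hij⟩ : ∃ i j, 0 < m i j := by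
    by_contra hcon
    push Not at hcon
    apply hA0
    rw [← star_mul_mul_eq_zero_iff' hUm A, ← hA']
    ext j i
    have h := le_antisymm (hcon i j) (hm0 i j)
    simp only [hm] at h
    exact norm_eq_zero.1 (pow_eq_zero_iff two_ne_zero |>.1 h)
  have hS₁ : 0 < ∑ i, ∑ j, m i j * W j := by
    refine lt_of_lt_of_le (mul_pos hij (hW0 j₀)) ?_
    refine (Finset.single_le_sum (f := fun j => m i₀ j * W j) (fun j _ => mul_nonneg (hm0 _ _) (hW0 j).le)
      (mem_univ j₀)).trans ?_
    exact Finset.single_le_sum (f := fun i => ∑ j, m i j * W j)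
      (fun i _ => sum_nonneg fun j _ => mul_nonneg (hm0 _ _) (hW0 j).le) (mem_univ i₀)
  have hS₂ : 0 < ∑ i, ∑ j, m i j * W i := by
    refine lt_of_lt_of_le (mul_pos hij (hW0 i₀)) ?_
    refine (Finset.single_le_sum (f := fun j => m i₀ j * W i₀) (fun j _ => mul_nonneg (hm0 _ _) (hW0 _).le)
      (mem_univ j₀)).trans ?_
    exact Finset.single_le_sum (f := fun i => ∑ j, m i j * W i)
      (fun i _ => sum_nonneg fun j _ => mul_nonneg (hm0 _ _) (hW0 i).le) (mem_univ i₀)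
  have hpos₁ : 0 < (gibbsState β H (A * Aᴴ)).re := by rw [hu₁]; exact mul_pos (inv_pos.2 hZr0) hS₁
  have hpos₂ : 0 < (gibbsState β H (Aᴴ * A)).re := by rw [hu₂]; exact mul_pos (inv_pos.2 hZr0) hS₂
  -- the Duhamel side as an integral of the two-weight pair sum
  have hb : (duhamel β H Aᴴ A).re =
      Zr⁻¹ * ∫ s in (0 : ℝ)..1, ∑ i, ∑ j, m i j * Real.exp (-(β * (s * E j + (1 - s) * E i))) := by
    rw [re_duhamel_conjTranspose_mul_self_eq hH A β, integral_sum_sum_mul_exp]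
  -- pointwise: the exponential is `W_j^s W_i^{1-s}` and Hölder applies
  have hexp : ∀ s : ℝ, ∀ i j, Real.exp (-(β * (s * E j + (1 - s) * E i))) = W j ^ s * W i ^ (1 - s) := by
    intro s i j
    simp only [hW]
    rw [← Real.exp_mul, ← Real.exp_mul, ← Real.exp_add]
    congr 1
    ring
  have hpt : ∀ s ∈ Set.Icc (0 : ℝ) 1,
      ∑ i, ∑ j, m i j * Real.exp (-(β * (s * E j + (1 - s) * E i))) ≤
        (∑ i, ∑ j, m i j * W j) ^ s * (∑ i, ∑ j, m i j * W i) ^ (1 - s) := by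
    intro s hs
    simp_rw [hexp s]
    have h := sum_mul_rpow_mul_rpow_le (univ : Finset (n × n)) (fun p => m p.1 p.2) (fun p => W p.2)
      (fun p => W p.1) (fun p _ => hm0 _ _) (fun p _ => (hW0 _).le) (fun p _ => (hW0 _).le) hs.1 hs.2
      (by simpa only [Fintype.sum_prod_type] using hS₁) (by simpa only [Fintype.sum_prod_type] using hS₂)
    simpa only [Fintype.sum_prod_type] using h
  -- integrate
  have hcontL : Continuous fun s : ℝ => ∑ i, ∑ j, m i j * Real.exp (-(β * (s * E j + (1 - s) * E i))) := by
    fun_prop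
  have hcontR : Continuous fun s : ℝ =>
      (∑ i, ∑ j, m i j * W j) ^ s * (∑ i, ∑ j, m i j * W i) ^ (1 - s) :=
    (Real.continuous_const_rpow hS₁.ne').mul
      ((Real.continuous_const_rpow hS₂.ne').comp (continuous_const.sub continuous_id))
  have hint : ∫ s in (0 : ℝ)..1, ∑ i, ∑ j, m i j * Real.exp (-(β * (s * E j + (1 - s) * E i))) ≤
      ∫ s in (0 : ℝ)..1, (∑ i, ∑ j, m i j * W j) ^ s * (∑ i, ∑ j, m i j * W i) ^ (1 - s) :=
    intervalIntegral.integral_mono_on zero_le_one (hcontL.intervalIntegrable _ _)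
      (hcontR.intervalIntegrable _ _) hpt
  -- `(Zr u₁)^s (Zr u₂)^{1-s} = Zr · u₁^s u₂^{1-s}`
  have hsplit : ∀ s : ℝ, (∑ i, ∑ j, m i j * W j) ^ s * (∑ i, ∑ j, m i j * W i) ^ (1 - s) =
      Zr * ((gibbsState β H (A * Aᴴ)).re ^ s * (gibbsState β H (Aᴴ * A)).re ^ (1 - s)) := by
    intro s
    have e1 : ∑ i, ∑ j, m i j * W j = Zr * (gibbsState β H (A * Aᴴ)).re := by
      rw [hu₁, ← mul_assoc, mul_inv_cancel₀ hZr0.ne', one_mul]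
    have e2 : ∑ i, ∑ j, m i j * W i = Zr * (gibbsState β H (Aᴴ * A)).re := by
      rw [hu₂, ← mul_assoc, mul_inv_cancel₀ hZr0.ne', one_mul]
    rw [e1, e2, Real.mul_rpow hZr0.le hpos₁.le, Real.mul_rpow hZr0.le hpos₂.le]
    have hz : Zr ^ s * Zr ^ (1 - s) = Zr := by
      rw [← Real.rpow_add hZr0]; norm_num
    calc Zr ^ s * (gibbsState β H (A * Aᴴ)).re ^ s * (Zr ^ (1 - s) * (gibbsState β H (Aᴴ * A)).re ^ (1 - s))
        = (Zr ^ s * Zr ^ (1 - s)) * ((gibbsState β H (A * Aᴴ)).re ^ s *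
            (gibbsState β H (Aᴴ * A)).re ^ (1 - s)) := by ring
      _ = _ := by rw [hz]
  simp_rw [hsplit] at hint
  rw [intervalIntegral.integral_const_mul] at hint
  rw [hb]
  calc Zr⁻¹ * ∫ s in (0 : ℝ)..1, ∑ i, ∑ j, m i j * Real.exp (-(β * (s * E j + (1 - s) * E i)))
      ≤ Zr⁻¹ * (Zr * ∫ s in (0 : ℝ)..1,
          (gibbsState β H (A * Aᴴ)).re ^ s * (gibbsState β H (Aᴴ * A)).re ^ (1 - s)) :=
        mul_le_mul_of_nonneg_left hint (inv_nonneg.2 hZr0.le)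
    _ = _ := by rw [← mul_assoc, inv_mul_cancel₀ hZr0.ne', one_mul]

/-- **Bogoliubov's inequality with the logarithmic mean** (the "Roepstorff-type" sharpening of
[DLS1978] (28)): for Hermitian `H`, `β ≥ 0` and any `A`, `C`,
`|⟨CA − AC⟩_β|² ≤ β · L(Re⟨AAᴴ⟩_β, Re⟨AᴴA⟩_β) · Re⟨[Cᴴ,[H,C]]⟩_β` with
`L(a,b) = ∫₀¹ a^s b^{1-s} ds ≤ (a+b)/2` (from `bogoliubov_inequality_duhamel_general` and the log-mean
bound on the Duhamel function). [cite: DLS1978, §2 eqs. (22′), (26), (28)] -/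
theorem bogoliubov_inequality_logMean_general (hH : H.IsHermitian) (A C : Matrix n n ℂ) {β : ℝ}
    (hβ : 0 ≤ β) :
    ‖gibbsState β H (C * A - A * C)‖ ^ 2 ≤
      β * (∫ s in (0 : ℝ)..1, (gibbsState β H (A * Aᴴ)).re ^ s * (gibbsState β H (Aᴴ * A)).re ^ (1 - s)) *
        (gibbsState β H (Cᴴ * (H * C - C * H) - (H * C - C * H) * Cᴴ)).re := by
  refine (bogoliubov_inequality_duhamel_general hH A C hβ).trans ?_
  exact mul_le_mul_of_nonneg_right
    (mul_le_mul_of_nonneg_left (re_duhamel_conjTranspose_mul_self_le_integral_rpow hH A β) hβ)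
    (re_gibbsState_doubleComm_general_nonneg hH C hβ)

end Spectral

end Literature.MathematicalPhysics.QuantumLattice
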